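import Summits.AtomisticToContinuum.HydrodynamicLimit.Theorems.CollisionIsometryCLTAdaptedWeightCLTBHEntropyBudgetGauss
import Summits.AtomisticToContinuum.HydrodynamicLimit.Theorems.CollisionIsometryCLTAdaptedWeightCLTBHDVTransferChaos
import Literature.MathematicalPhysics.KineticTheory.HydrodynamicLimitsMomentsProofs
import Literature.Analysis.UnboundedOperators.LinearizedBoltzmannPositivityProofs

/-!
# Stub `stub_eepClosure` (S5) of the line `block-h-dissipation-closure`, helper file 1: GAUSSIAN MOMENTS up to
order three of the mollifier and of the Maxwellian floor
(crux `CollisionIsometryCLT.AdaptedWeightCLT`, stmt-AtomisticToContinuum-14868; `--supports`)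

Pure Gaussian-moment algebra on `V3 = ℝ³` (no dynamics, no probability): the per-atom half of step (iv) of the
planner's sketch of `stub_eepClosure` (the EXACT `(1 − δ)` moment identities of the regularised cell law, assembled
over the cell in helper file 2). For the traceless quadratic tests `p₂(w) = (w−u)_j (w−u)_k − δ_{jk}|w−u|²/3`
(`p2Poly`) and the heat-flux tests `p₃(w) = ½|w−u|² (w−u)_a` (`p3Poly`), centred at an arbitrary `u`:
* `∫ G_h(w − c) p₂(w) dw = p₂(c)` (`integral_gauss_mul_p2Poly`): Gaussian smoothing adds `h² 𝟙` to the second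
  moments, and `h² 𝟙` is traceless-free;
* `∫ G_h(w − c) p₃(w) dw = p₃(c) + (5/2) h² (c − u)_a` (`integral_gauss_mul_p3Poly`);
* `∫ M_{1,θ,u} p₂ = 0`, `∫ M_{1,θ,u} p₃ = 0` (`integral_localMaxwellian_mul_p2Poly/p3Poly`): the isotropic floor
  centred at `u` has neither traceless second nor third central moments.
Tools: the transfer identity `∫ G_h(w − c) g(w) dw = ∫ g(c + h z) dγ(z)` (`integral_gauss_mul`, from
`Literature.MathematicalPhysics.KineticTheory.integral_localMaxwellian_smul`), coordinate moments of the standard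
Gaussian `γ` on `ℝ³` up to order three (odd ones by the symmetry `z ↦ −z`, no integrability needed:
`integral_eq_zero_of_odd`), and an integrability criterion for `G_h ×` (continuous, polynomially bounded)
(`integrable_gauss_mul_of_le`, through the `ℝ≥0∞` transfer `lintegral_gauss_mul`).
Registered anchor: `bhEEPClosure_moments_anchor` (the `p₂` identity with `p₂` unfolded, `∀`-closed).
-/

namespace Summit.AtomisticToContinuum.HydrodynamicLimit.Theorems.BlockHDissipation

open scoped BigOperators Topology Classical MeasureTheory ENNReal InnerProductSpace
open Filter Set MeasureTheory ProbabilityTheory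
open Literature.Analysis.FluidPDE
open Summit.AtomisticToContinuum.HydrodynamicLimit.Theorems.ContactSourceDuhamel (T3 V3 Cfg Vel Flow Flows)
open Literature.MathematicalPhysics.KineticTheory (integral_localMaxwellian_smul localMaxwellian_pos
  localMaxwellian_nonneg continuous_localMaxwellian integral_localMaxwellian_one integrable_localMaxwellian
  withDensity_localMaxwellian_eq_gaussMeasure gaussMeasure integral_coord_stdGaussian integral_coord_sq_stdGaussian
  integral_norm_sq_stdGaussian integrable_norm_sq_stdGaussian integral_stdGaussian_eq_zero_of_odd_vec
  integral_inner_mul_inner_stdGaussian)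

noncomputable section

namespace EEP

open EntropyBudget (gauss_eq gauss_pos)
open DVTransfer (continuous_gauss)

/-! ## The standard Gaussian on `ℝ³`: moments up to order three -/

/-- A continuous function of polynomial growth is `γ`-integrable. -/
theorem integrable_gamma_of_le {g : V3 → ℝ} (hg : Continuous g) {C : ℝ} {k : ℕ}
    (hle : ∀ z, |g z| ≤ C * (1 + ‖z‖) ^ k) : Integrable g (stdGaussian V3) :=
  Integrable.mono' ((Literature.Analysis.UnboundedOperators.integrable_one_add_norm_pow_stdGaussian k).const_mul C)
    hg.aestronglyMeasurable
    (ae_of_all _ fun z => by rw [Real.norm_eq_abs]; exact hle z)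

/-- The norm is bounded by `1 + ‖z‖`. -/
theorem norm_le_one_add (z : V3) : ‖z‖ ≤ 1 + ‖z‖ := by linarith [norm_nonneg z]

/-- A coordinate is bounded by `1 + ‖z‖`. -/
theorem abs_coord_le (z : V3) (j : Fin 3) : |z j| ≤ 1 + ‖z‖ :=
  ((Real.norm_eq_abs _).symm.le.trans (PiLp.norm_apply_le z j)).trans (norm_le_one_add z)

/-- Coordinates are integrable. -/
theorem integrable_coord (j : Fin 3) : Integrable (fun z : V3 => z j) (stdGaussian V3) :=
  integrable_gamma_of_le (by fun_prop) (C := 1) (k := 1) fun z => by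
    rw [one_mul, pow_one]; exact abs_coord_le z j

/-- Products of two coordinates are integrable. -/
theorem integrable_coord_mul_coord (j k : Fin 3) : Integrable (fun z : V3 => z j * z k) (stdGaussian V3) :=
  integrable_gamma_of_le (by fun_prop) (C := 1) (k := 2) fun z => by
    rw [one_mul, abs_mul]
    have h1 := abs_coord_le z j
    have h2 := abs_coord_le z k
    nlinarith [abs_nonneg (z j), abs_nonneg (z k)]

/-- `⟪a, z⟫ z_k` is integrable. -/
theorem integrable_inner_mul_coord (a : V3) (k : Fin 3) : Integrable (fun z : V3 => ⟪a, z⟫_ℝ * z k) (stdGaussian V3) :=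
  integrable_gamma_of_le (by fun_prop) (C := ‖a‖) (k := 2) fun z => by
    rw [abs_mul]
    have h1 : |⟪a, z⟫_ℝ| ≤ ‖a‖ * ‖z‖ := abs_real_inner_le_norm a z
    have h2 := abs_coord_le z k
    have h3 := norm_le_one_add z
    calc |⟪a, z⟫_ℝ| * |z k| ≤ (‖a‖ * ‖z‖) * (1 + ‖z‖) :=
          mul_le_mul h1 h2 (abs_nonneg _) (by positivity)
      _ ≤ ‖a‖ * (1 + ‖z‖) ^ 2 := by
          rw [sq, ← mul_assoc]
          exact mul_le_mul_of_nonneg_right (mul_le_mul_of_nonneg_left h3 (norm_nonneg _)) (by positivity)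

/-- First moments vanish: `∫ z_j dγ = 0`. -/
theorem integral_coord (j : Fin 3) : ∫ z, z j ∂(stdGaussian V3) = 0 := integral_coord_stdGaussian j

/-- Second moments: `∫ z_j z_k dγ = δ_{jk}`. -/
theorem integral_coord_mul_coord (j k : Fin 3) : ∫ z, z j * z k ∂(stdGaussian V3) = if j = k then 1 else 0 := by
  have h := integral_inner_mul_inner_stdGaussian (EuclideanSpace.single j (1 : ℝ)) (EuclideanSpace.single k (1 : ℝ))
  simp only [EuclideanSpace.inner_single_left, map_one, one_mul, PiLp.single_apply] at h
  rw [h]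

/-- Mixed second moments: `∫ ⟪a, z⟫ z_k dγ = a_k`. -/
theorem integral_inner_mul_coord (a : V3) (k : Fin 3) : ∫ z, ⟪a, z⟫_ℝ * z k ∂(stdGaussian V3) = a k := by
  have h := integral_inner_mul_inner_stdGaussian a (EuclideanSpace.single k (1 : ℝ))
  simp only [EuclideanSpace.inner_single_left, EuclideanSpace.inner_single_right, map_one, one_mul] at h
  exact h

/-- `∫ |z|² dγ = 3`. -/
theorem integral_norm_sq_three : ∫ z, ‖z‖ ^ 2 ∂(stdGaussian V3) = 3 := by
  rw [integral_norm_sq_stdGaussian]; simp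

/-- Odd integrands (under `z ↦ −z`) integrate to zero, with no integrability proviso. -/
theorem integral_eq_zero_of_odd {g : V3 → ℝ} (hg : ∀ z, g (-z) = -g z) : ∫ z, g z ∂(stdGaussian V3) = 0 :=
  integral_stdGaussian_eq_zero_of_odd_vec (LinearIsometryEquiv.neg ℝ) (g := g) fun z => by
    simpa using hg z

/-! ## The Gaussian mollifier: transfer and integrability -/

/-- **Transfer identity** for the mollifier: `∫ G_h(w − c) g(w) dw = ∫ g(c + h z) dγ(z)`. -/
theorem integral_gauss_mul {h : ℝ} (hh : 0 < h) (c : V3) (g : V3 → ℝ) :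
    ∫ w, gauss h c w * g w = ∫ z, g (c + h • z) ∂(stdGaussian V3) := by
  have h1 := integral_localMaxwellian_smul (F := ℝ) (pow_pos hh 2) c g
  simp only [smul_eq_mul] at h1
  rw [Real.sqrt_sq hh.le] at h1
  exact h1

/-- Transfer identity for `ℝ≥0∞`-valued integrands. -/
theorem lintegral_gauss_mul {h : ℝ} (hh : 0 < h) (c : V3) (G : V3 → ℝ≥0∞) :
    ∫⁻ w, ENNReal.ofReal (gauss h c w) * G w = ∫⁻ z, G (c + h • z) ∂(stdGaussian V3) := by
  have hθ : 0 < h ^ 2 := pow_pos hh 2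
  have h1 := lintegral_withDensity_eq_lintegral_mul_non_measurable (volume : Measure V3)
    (f := fun w => ENNReal.ofReal (gauss h c w)) (continuous_gauss h c).measurable.ennreal_ofReal
    (Eventually.of_forall fun _ => ENNReal.ofReal_lt_top) G
  rw [show (∫⁻ w, ENNReal.ofReal (gauss h c w) * G w) = ∫⁻ a, ((fun w => ENNReal.ofReal (gauss h c w)) * G) a
      from rfl, ← h1]
  rw [show (fun w => ENNReal.ofReal (gauss h c w)) = fun w => ENNReal.ofReal (localMaxwellian 1 (h ^ 2) c w)
      from rfl, withDensity_localMaxwellian_eq_gaussMeasure hθ c, gaussMeasure,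
    ← Literature.MathematicalPhysics.KineticTheory.coe_gaussShiftEquiv c hθ, lintegral_map_equiv]
  simp only [Literature.MathematicalPhysics.KineticTheory.coe_gaussShiftEquiv, Real.sqrt_sq hh.le]

/-- **Integrability against the mollifier**: a continuous `g` of polynomial growth has `G_h(· − c) g`
integrable on `ℝ³`. -/
theorem integrable_gauss_mul_of_le {h : ℝ} (hh : 0 < h) (c : V3) {g : V3 → ℝ} (hg : Continuous g)
    {C : ℝ} {k : ℕ} (hle : ∀ w, |g w| ≤ C * (1 + ‖w‖) ^ k) :
    Integrable (fun w => gauss h c w * g w) := by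
  have hC : 0 ≤ C := le_trans (abs_nonneg _) ((hle 0).trans (by simp))
  -- dominate by `C (1+|c|)^k (1+h)^k · G_h (1+|z|)^k` after transfer; we go through the lintegral
  have hmeas : AEStronglyMeasurable (fun w => gauss h c w * g w) volume :=
    ((continuous_gauss h c).mul hg).aestronglyMeasurable
  refine ⟨hmeas, ?_⟩
  have hbound : ∀ w, ‖gauss h c w * g w‖ₑ ≤ ENNReal.ofReal (gauss h c w) * ENNReal.ofReal (C * (1 + ‖w‖) ^ k) := by
    intro w
    rw [← ENNReal.ofReal_mul (gauss_pos hh c w).le, Real.enorm_eq_ofReal_abs, abs_mul,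
      abs_of_pos (gauss_pos hh c w)]
    exact ENNReal.ofReal_le_ofReal (mul_le_mul_of_nonneg_left (hle w) (gauss_pos hh c w).le)
  refine lt_of_le_of_lt (lintegral_mono hbound) ?_
  rw [lintegral_gauss_mul hh c]
  -- `(1 + |c + h z|)^k ≤ ((1 + |c|)(1 + h))^k (1 + |z|)^k`
  set A : ℝ := ((1 + ‖c‖) * (1 + h)) ^ k with hA
  have hpt : ∀ z : V3, C * (1 + ‖c + h • z‖) ^ k ≤ C * A * (1 + ‖z‖) ^ k := by
    intro z
    rw [mul_assoc, hA, ← mul_pow]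
    refine mul_le_mul_of_nonneg_left (pow_le_pow_left₀ (by positivity) ?_ k) hC
    have hz : ‖c + h • z‖ ≤ ‖c‖ + h * ‖z‖ := by
      refine (norm_add_le _ _).trans ?_
      rw [norm_smul, Real.norm_eq_abs, abs_of_pos hh]
    nlinarith [norm_nonneg c, norm_nonneg z, hh.le, mul_nonneg (norm_nonneg c) (norm_nonneg z),
      mul_nonneg hh.le (norm_nonneg c)]
  have hfin := ((Literature.Analysis.UnboundedOperators.integrable_one_add_norm_pow_stdGaussian (E := V3) k).const_mul
    (C * A)).hasFiniteIntegral
  rw [hasFiniteIntegral_iff_enorm] at hfin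
  refine lt_of_le_of_lt (lintegral_mono fun z => ?_) hfin
  rw [Real.enorm_eq_ofReal_abs, abs_of_nonneg (by positivity)]
  exact ENNReal.ofReal_le_ofReal (hpt z)

/-- `|z|² z_a` is integrable. -/
theorem integrable_norm_sq_mul_coord (a : Fin 3) : Integrable (fun z : V3 => ‖z‖ ^ 2 * z a) (stdGaussian V3) :=
  integrable_gamma_of_le (by fun_prop) (C := 1) (k := 3) fun z => by
    rw [abs_mul, abs_of_nonneg (sq_nonneg _), one_mul, pow_succ]
    exact mul_le_mul (pow_le_pow_left₀ (norm_nonneg _) (norm_le_one_add z) 2)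
      (abs_coord_le z a) (abs_nonneg _) (pow_nonneg (by positivity) 2)

/-- Scaled linear forms `r ⟪a, z⟫` are integrable. -/
theorem integrable_const_mul_inner (r : ℝ) (a : V3) : Integrable (fun z : V3 => r * ⟪a, z⟫_ℝ) (stdGaussian V3) :=
  integrable_gamma_of_le (by fun_prop) (C := |r| * ‖a‖) (k := 1) fun z => by
    rw [pow_one, abs_mul, mul_assoc]
    exact mul_le_mul_of_nonneg_left
      ((abs_real_inner_le_norm a z).trans (mul_le_mul_of_nonneg_left (norm_le_one_add z) (norm_nonneg _)))
      (abs_nonneg r)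

/-- Constants integrate to themselves (`γ` is a probability measure). -/
theorem integral_const_gamma (c : ℝ) : ∫ _z, c ∂(stdGaussian V3) = c := by simp

/-! ## The traceless quadratic and the heat-flux test polynomials -/

/-- The traceless quadratic test centred at `u`: `p₂(w) = (w−u)_j (w−u)_k − δ_{jk} |w−u|²/3`. -/
def p2Poly (u : V3) (j k : Fin 3) (w : V3) : ℝ :=
  (w j - u j) * (w k - u k) - if j = k then ‖w - u‖ ^ 2 / 3 else 0

/-- The heat-flux test centred at `u`: `p₃(w) = ½ |w−u|² (w−u)_a`. -/
def p3Poly (u : V3) (a : Fin 3) (w : V3) : ℝ := ‖w - u‖ ^ 2 / 2 * (w a - u a)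

/-- `p₂` is continuous. -/
theorem continuous_p2Poly (u : V3) (j k : Fin 3) : Continuous (p2Poly u j k) := by
  unfold p2Poly; split_ifs <;> fun_prop

/-- `p₃` is continuous. -/
theorem continuous_p3Poly (u : V3) (a : Fin 3) : Continuous (p3Poly u a) := by
  unfold p3Poly; fun_prop

/-- Growth of `p₂`: `|p₂(w)| ≤ 2 (1 + |u|)² (1 + |w|)²`. -/
theorem abs_p2Poly_le (u : V3) (j k : Fin 3) (w : V3) : |p2Poly u j k w| ≤ 2 * (1 + ‖u‖) ^ 2 * (1 + ‖w‖) ^ 2 := by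
  have hwu : ‖w - u‖ ≤ (1 + ‖u‖) * (1 + ‖w‖) := by
    have := norm_sub_le w u
    nlinarith [norm_nonneg u, norm_nonneg w, mul_nonneg (norm_nonneg u) (norm_nonneg w)]
  have hco : ∀ l : Fin 3, |w l - u l| ≤ ‖w - u‖ := fun l => by
    have := (Real.norm_eq_abs _).symm.le.trans (PiLp.norm_apply_le (w - u) l)
    simpa only [PiLp.sub_apply] using this
  have h1 : |(w j - u j) * (w k - u k)| ≤ ‖w - u‖ ^ 2 := by
    rw [abs_mul, sq]
    exact mul_le_mul (hco j) (hco k) (abs_nonneg _) (norm_nonneg _)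
  have h2 : |(if j = k then ‖w - u‖ ^ 2 / 3 else 0 : ℝ)| ≤ ‖w - u‖ ^ 2 := by
    split_ifs
    · rw [abs_of_nonneg (by positivity)]; nlinarith [sq_nonneg ‖w - u‖]
    · simp
  have hsq : ‖w - u‖ ^ 2 ≤ ((1 + ‖u‖) * (1 + ‖w‖)) ^ 2 := pow_le_pow_left₀ (norm_nonneg _) hwu 2
  calc |p2Poly u j k w| ≤ ‖w - u‖ ^ 2 + ‖w - u‖ ^ 2 := (abs_sub _ _).trans (add_le_add h1 h2)
    _ ≤ 2 * (1 + ‖u‖) ^ 2 * (1 + ‖w‖) ^ 2 := by rw [mul_pow] at hsq; linarith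

/-- Growth of `p₃`: `|p₃(w)| ≤ (1 + |u|)³ (1 + |w|)³`. -/
theorem abs_p3Poly_le (u : V3) (a : Fin 3) (w : V3) : |p3Poly u a w| ≤ (1 + ‖u‖) ^ 3 * (1 + ‖w‖) ^ 3 := by
  have hwu : ‖w - u‖ ≤ (1 + ‖u‖) * (1 + ‖w‖) := by
    have := norm_sub_le w u
    nlinarith [norm_nonneg u, norm_nonneg w, mul_nonneg (norm_nonneg u) (norm_nonneg w)]
  have ha : |w a - u a| ≤ ‖w - u‖ := by
    have := (Real.norm_eq_abs _).symm.le.trans (PiLp.norm_apply_le (w - u) a)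
    simpa only [PiLp.sub_apply] using this
  unfold p3Poly
  rw [abs_mul, abs_of_nonneg (by positivity), ← mul_pow]
  have h3 : ‖w - u‖ ^ 2 / 2 * |w a - u a| ≤ ‖w - u‖ ^ 3 := by
    have := mul_le_mul_of_nonneg_left ha (by positivity : (0 : ℝ) ≤ ‖w - u‖ ^ 2 / 2)
    nlinarith [pow_nonneg (norm_nonneg (w - u)) 3]
  exact h3.trans (pow_le_pow_left₀ (norm_nonneg _) hwu 3)

/-! ## Transfer and integrability against a Maxwellian of any temperature -/

/-- A continuous `g` of polynomial growth has `M_{1,θ,c} g` integrable (`θ > 0`). -/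
theorem integrable_localMaxwellian_mul_of_le {θ : ℝ} (hθ : 0 < θ) (c : V3) {g : V3 → ℝ} (hg : Continuous g)
    {C : ℝ} {k : ℕ} (hle : ∀ w, |g w| ≤ C * (1 + ‖w‖) ^ k) :
    Integrable (fun w => localMaxwellian 1 θ c w * g w) := by
  have h := integrable_gauss_mul_of_le (Real.sqrt_pos.2 hθ) c hg hle
  simpa only [gauss_eq, Real.sq_sqrt hθ.le] using h

/-- **`∫ G_h(w − c) p₂(w) dw = p₂(c)`**: Gaussian smoothing does not change the traceless second moment about
any centre (it adds `h² 𝟙`, whose traceless part vanishes). -/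
theorem integral_gauss_mul_p2Poly {h : ℝ} (hh : 0 < h) (c u : V3) (j k : Fin 3) :
    ∫ w, gauss h c w * p2Poly u j k w = p2Poly u j k c := by
  rw [integral_gauss_mul hh]
  by_cases hjk : j = k
  · subst hjk
    -- even part `E`, odd part `O`
    set E : V3 → ℝ := fun z => (c j - u j) ^ 2 + h ^ 2 * (z j * z j) - (‖c - u‖ ^ 2 + h ^ 2 * ‖z‖ ^ 2) / 3
    set O : V3 → ℝ := fun z => 2 * h * (c j - u j) * z j - 2 * h * ⟪c - u, z⟫_ℝ / 3
    have hsplit : ∀ z : V3, p2Poly u j j (c + h • z) = E z + O z := by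
      intro z
      simp only [p2Poly, if_true, E, O, PiLp.add_apply, PiLp.smul_apply, smul_eq_mul]
      rw [show c + h • z - u = (c - u) + h • z by abel, norm_add_sq_real, norm_smul, Real.norm_eq_abs,
        abs_of_pos hh, real_inner_smul_right]
      ring
    have hE1 : Integrable (fun z : V3 => (c j - u j) ^ 2 + h ^ 2 * (z j * z j)) (stdGaussian V3) :=
      (integrable_const _).fun_add ((integrable_coord_mul_coord j j).const_mul _)
    have hE2 : Integrable (fun z : V3 => (‖c - u‖ ^ 2 + h ^ 2 * ‖z‖ ^ 2) / 3) (stdGaussian V3) :=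
      ((integrable_const _).fun_add (integrable_norm_sq_stdGaussian.const_mul _)).div_const 3
    have hE : Integrable E (stdGaussian V3) := hE1.sub' hE2
    have hO : Integrable O (stdGaussian V3) :=
      ((integrable_coord j).const_mul _).sub' ((integrable_const_mul_inner (2 * h) (c - u)).div_const 3)
    have hOodd : ∫ z, O z ∂(stdGaussian V3) = 0 := integral_eq_zero_of_odd fun z => by
      simp only [O, PiLp.neg_apply, inner_neg_right]; ring
    have hIE : ∫ z, E z ∂(stdGaussian V3) = (c j - u j) ^ 2 + h ^ 2 * 1 - (‖c - u‖ ^ 2 + h ^ 2 * 3) / 3 := by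
      simp only [E]
      rw [integral_sub hE1 hE2, integral_add (integrable_const _) ((integrable_coord_mul_coord j j).const_mul _),
        integral_div, integral_add (integrable_const _) (integrable_norm_sq_stdGaussian.const_mul _),
        integral_const_gamma, integral_const_gamma, integral_const_mul, integral_const_mul,
        integral_coord_mul_coord, integral_norm_sq_three, if_pos rfl]
    simp_rw [hsplit]
    rw [integral_add hE hO, hOodd, add_zero, hIE]
    simp only [p2Poly, if_true]
    ring
  · set E : V3 → ℝ := fun z => (c j - u j) * (c k - u k) + h ^ 2 * (z j * z k)
    set O : V3 → ℝ := fun z => h * ((c j - u j) * z k) + h * ((c k - u k) * z j)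
    have hsplit : ∀ z : V3, p2Poly u j k (c + h • z) = E z + O z := by
      intro z
      simp only [p2Poly, hjk, if_false, sub_zero, E, O, PiLp.add_apply, PiLp.smul_apply, smul_eq_mul]
      ring
    have hE : Integrable E (stdGaussian V3) := (integrable_const _).fun_add ((integrable_coord_mul_coord j k).const_mul _)
    have hO : Integrable O (stdGaussian V3) :=
      (((integrable_coord k).const_mul _).const_mul h).fun_add (((integrable_coord j).const_mul _).const_mul h)
    have hOodd : ∫ z, O z ∂(stdGaussian V3) = 0 := integral_eq_zero_of_odd fun z => by
      simp only [O, PiLp.neg_apply]; ring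
    have hIE : ∫ z, E z ∂(stdGaussian V3) = (c j - u j) * (c k - u k) + h ^ 2 * 0 := by
      simp only [E]
      rw [integral_add (integrable_const _) ((integrable_coord_mul_coord j k).const_mul _), integral_const_gamma,
        integral_const_mul, integral_coord_mul_coord, if_neg hjk]
    simp_rw [hsplit]
    rw [integral_add hE hO, hOodd, add_zero, hIE]
    simp only [p2Poly, hjk, if_false]
    ring

/-- **`∫ G_h(w − c) p₃(w) dw = p₃(c) + (5/2) h² (c − u)_a`**: per atom, Gaussian smoothing shifts the third
central moment by a multiple of the first. -/
theorem integral_gauss_mul_p3Poly {h : ℝ} (hh : 0 < h) (c u : V3) (a : Fin 3) :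
    ∫ w, gauss h c w * p3Poly u a w = p3Poly u a c + 5 / 2 * h ^ 2 * (c a - u a) := by
  rw [integral_gauss_mul hh]
  set E : V3 → ℝ := fun z =>
    ‖c - u‖ ^ 2 / 2 * (c a - u a) + h ^ 2 / 2 * (c a - u a) * ‖z‖ ^ 2 + h ^ 2 * (⟪c - u, z⟫_ℝ * z a)
  set O : V3 → ℝ := fun z =>
    h * ‖c - u‖ ^ 2 / 2 * z a + h * (c a - u a) * ⟪c - u, z⟫_ℝ + h ^ 3 / 2 * (‖z‖ ^ 2 * z a)
  have hsplit : ∀ z : V3, p3Poly u a (c + h • z) = E z + O z := by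
    intro z
    simp only [p3Poly, E, O, PiLp.add_apply, PiLp.smul_apply, smul_eq_mul]
    rw [show c + h • z - u = (c - u) + h • z by abel, norm_add_sq_real, norm_smul, Real.norm_eq_abs,
      abs_of_pos hh, real_inner_smul_right]
    ring
  have hE1 : Integrable (fun z : V3 => ‖c - u‖ ^ 2 / 2 * (c a - u a) + h ^ 2 / 2 * (c a - u a) * ‖z‖ ^ 2) (stdGaussian V3) :=
    (integrable_const _).fun_add (integrable_norm_sq_stdGaussian.const_mul _)
  have hE : Integrable E (stdGaussian V3) := hE1.fun_add ((integrable_inner_mul_coord _ a).const_mul _)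
  have hO : Integrable O (stdGaussian V3) :=
    (((integrable_coord a).const_mul _).fun_add (integrable_const_mul_inner _ _)).fun_add
      ((integrable_norm_sq_mul_coord a).const_mul _)
  have hOodd : ∫ z, O z ∂(stdGaussian V3) = 0 := integral_eq_zero_of_odd fun z => by
    simp only [O, PiLp.neg_apply, inner_neg_right, norm_neg]; ring
  have hIE : ∫ z, E z ∂(stdGaussian V3) =
      ‖c - u‖ ^ 2 / 2 * (c a - u a) + h ^ 2 / 2 * (c a - u a) * 3 + h ^ 2 * (c - u) a := by
    simp only [E]
    rw [integral_add hE1 ((integrable_inner_mul_coord _ a).const_mul _),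
      integral_add (integrable_const _) (integrable_norm_sq_stdGaussian.const_mul _), integral_const_gamma, integral_const_mul,
      integral_const_mul, integral_norm_sq_three, integral_inner_mul_coord]
  simp_rw [hsplit]
  rw [integral_add hE hO, hOodd, add_zero, hIE, PiLp.sub_apply]
  simp only [p3Poly]
  ring

/-- **The isotropic Maxwellian has no traceless second moment**: `∫ M_{1,θ,u} p₂ = 0`. -/
theorem integral_localMaxwellian_mul_p2Poly {θ : ℝ} (hθ : 0 < θ) (u : V3) (j k : Fin 3) :
    ∫ w, localMaxwellian 1 θ u w * p2Poly u j k w = 0 := by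
  have h1 := integral_localMaxwellian_smul (F := ℝ) hθ u (p2Poly u j k)
  simp only [smul_eq_mul] at h1
  rw [h1]
  by_cases hjk : j = k
  · subst hjk
    have hsplit : ∀ z : V3, p2Poly u j j (u + Real.sqrt θ • z) =
        Real.sqrt θ ^ 2 * (z j * z j) - Real.sqrt θ ^ 2 * ‖z‖ ^ 2 / 3 := by
      intro z
      simp only [p2Poly, if_true, PiLp.add_apply, PiLp.smul_apply, smul_eq_mul, add_sub_cancel_left, norm_smul,
        Real.norm_eq_abs, abs_of_nonneg (Real.sqrt_nonneg θ)]
      ring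
    simp_rw [hsplit]
    rw [integral_sub ((integrable_coord_mul_coord j j).const_mul _) ((integrable_norm_sq_stdGaussian.const_mul _).div_const 3),
      integral_const_mul, integral_div, integral_const_mul, integral_coord_mul_coord, integral_norm_sq_three, if_pos rfl]
    ring
  · have hsplit : ∀ z : V3, p2Poly u j k (u + Real.sqrt θ • z) = Real.sqrt θ ^ 2 * (z j * z k) := by
      intro z
      simp only [p2Poly, hjk, if_false, sub_zero, PiLp.add_apply, PiLp.smul_apply, smul_eq_mul, add_sub_cancel_left]
      ring
    simp_rw [hsplit]
    rw [integral_const_mul, integral_coord_mul_coord, if_neg hjk, mul_zero]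

/-- **The centred Maxwellian has no third moment**: `∫ M_{1,θ,u} p₃ = 0` (odd symmetry about `u`). -/
theorem integral_localMaxwellian_mul_p3Poly {θ : ℝ} (hθ : 0 < θ) (u : V3) (a : Fin 3) :
    ∫ w, localMaxwellian 1 θ u w * p3Poly u a w = 0 := by
  have h1 := integral_localMaxwellian_smul (F := ℝ) hθ u (p3Poly u a)
  simp only [smul_eq_mul] at h1
  rw [h1]
  refine integral_eq_zero_of_odd fun z => ?_
  simp only [p3Poly, PiLp.add_apply, PiLp.smul_apply, PiLp.neg_apply, smul_eq_mul, add_sub_cancel_left, norm_smul,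
    norm_neg, smul_neg]
  ring

end EEP

/-- Registered anchor of this helper file: Gaussian smoothing does not change the traceless second moment about
any centre, `∫ G_h(w − c) p₂(w) dw = p₂(c)` (`EEP.integral_gauss_mul_p2Poly` with `p₂` unfolded). -/
theorem bhEEPClosure_moments_anchor : ∀ (h : ℝ), 0 < h → ∀ (c u : V3) (j k : Fin 3), ∫ w, gauss h c w * ((w j - u j) * (w k - u k) - if j = k then ‖w - u‖ ^ 2 / 3 else 0) = (c j - u j) * (c k - u k) - if j = k then ‖c - u‖ ^ 2 / 3 else 0 :=
  fun _ hh c u j k => EEP.integral_gauss_mul_p2Poly hh c u j k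

end

end Summit.AtomisticToContinuum.HydrodynamicLimit.Theorems.BlockHDissipation
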